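import Summits.QuantumFields.YangMills.Theorems.BalabanUVNodesN09ChartReadAveragingSubmersion
import Literature.MeasureTheory.Integral.AnalyticSubmersionNowhereFibreFlat
import Literature.MathematicalPhysics.QuantumFieldTheory.Balaban1983to89.HaarAnalyticZeroSetNowhereFlat

/-!
# NODE N09 [B12] · ROAD B — THE (2.9) THRESHOLDS READ IN THE CHART ARE «NOWHERE FIBRE-FLAT» ALONG THE CHART-READ (0.4) AVERAGE: the inhabitable
# replacement of transversality, AT THE RECORD'S COORDINATES (the `hnf` input of the flat-locus sharp engine for the determinant family)

Cell `pub-ymgap` (YM-PLAN Track A), DAG node N09 [Balaban1987RG1] (= [I]); width seat `pub-ymgap-dag-n09-w3` g5 (D-0149 width seat 3 of node N09);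
count-neutral helper keyed to K1⁹ `StabilityBRunRowsAtRecordR13SepCoPHV` = stmt-QuantumFields-27364 (`--kind proof --supports … --as helper`).  The junction this file
feeds is dag-n09-w2 g4's CLAIM-7∕INTENT-13 `…N09ContTransportOfLoopSmallSharp` («the (2.9) determinant family Γ of record and `hnf` from submersive coordinates stay
YOUR lanes — displayed here», INBOX l.≈36760), reading this seat's flat-locus engine `Literature.MeasureTheory.Integral.AnalyticSubmersionSharpDensityFibreFlat` (p627574)
and its criteria `…AnalyticSubmersionNowhereFibreFlat` (p629361) at dag-n09-w4 g5's chart-read averaging (`…N09ChartReadAveragingSmooth` ∕ `…Submersion`, p620237 ∕ p621434).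

WHY.  The flat-locus sharp engine needs, per threshold, NO transversality but the side condition «nowhere fibre-flat»: `Γ i (ψ A) A = 0 ⇒ ∃ᶠ A' → A` ON THE
FIBRE `ψ⁻¹(ψ A)` with `Γ i (ψ A) A' ≠ 0`.  By `AnalyticSubmersion.nowhereFibreFlat_of_submersiveCoordinates` it follows from (a) a factorisation of the threshold
through a coordinate `P i` with (b) empty-interior zero sets of the defining function and (c) the joint submersion `(Dψ(A), P i)` onto at every point of the window.
For the (2.9) cut-off read in the exponential chart at `U₀` — `Γ_b(y, A) = normSq det((ε₁²−2)·1 + W + Wᴴ)`, `W = ↑V^{(j)}(V_y)(b)⁻¹·e^{A b}·↑U₀(b)` at a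
NON-distinguished bond `b` (the distinguished bonds ARE the central bonds `β(c)`, definitionally) — (a) holds with `P b := (A ↦ A b)`; (b) is this seat's
`HaarAnalyticZeroSetNowhereFlat.frequently_normSq_detLevel_conj_expChart_ne_zero` (the level function is nowhere flat on the connected `SU(N)`; `Λ ∘ Θ = id`); and
(c) is THIS FILE's §1: at `A = 0` the onto-preimages of `Dψ_{U₀}(0)` constructed by dag-n09-w4 g5 (`exists_fderiv_chartRead_single_eq_single`) live on the CENTRAL
bonds, so the `b`-coordinate can be prescribed independently — `(Dψ_{U₀}(0), A ↦ A b)` is onto; surjectivity is an OPEN condition and `ψ` is `C^∞` at `0`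
(`contDiffAt_chartRead_avgFun`), so the joint submersion persists on a neighbourhood (§0, generic).  NO hypothesis on the critical letter `V^{(j)}` enters: §2 is stated for
an ARBITRARY letter `h b y ∈ SU(N)` — N07's regularity of the minimiser is NOT used here (it enters road B only through the continuity clause of the density).

WHAT IS PROVED (theorems only; 0 def, 0 instance, 0 notation, 0 sorry; axioms standard).
* §0 (generic) `eventually_range_eq_top` (a continuous family of continuous linear maps into a finite-dimensional space, onto at `x₀`, is onto near `x₀` — right
  inverse + openness of units in `F →L F`), `eventually_hasStrictFDerivAt_prod_range_eq_top` (`C¹` at `a` + `(DM(a), P)` onto ⇒ strict differentiability and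
  `(DM(x), P)` onto near `a`).
* §1 ★★ `range_fderiv_chartRead_prod_proj_eq_top` (`(Dψ_{U₀}(0), A ↦ A b)` onto for every NON-central `b`, on the α-guard, standing range),
  ★★★ `exists_nhds_submersive_bondCoordinates` (an open `O₀ ∋ 0` on which, for every non-central `b`, `ψ_{U₀}` is strictly differentiable and `(Dψ_{U₀}(A), A ↦ A b)` is
  onto — the `hsub` of `nowhereFibreFlat_of_submersiveCoordinates`).
* §2 ★ `analyticOnNhd_detFamily` (every member of the determinant family is real-analytic in the fine chart variable, for every coarse point and every critical letter),
  ★★★ `exists_nhds_nowhereFibreFlat_detFamily` (an open `O₀ ∋ 0` inside the chart box on which the determinant family over the non-central bonds is NOWHERE FIBRE-FLAT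
  along `ψ_{U₀}` — `ψ`, `Γ` enter through defining equations `hψ`, `hΓ`, instantiate with `rfl`).

HONEST SCOPE ∕ FRAMING.  LOCATED, count-neutral calculus BY NAME (w4's `exists_fderiv_chartRead_single_eq_single` ∕ `contDiffAt_chartRead_avgFun` ∕ `coe_expChart`;
Mathlib `ContinuousLinearMap.exists_rightInverse_of_surjective`, `Units.isOpen`, `HasStrictFDerivAt.map_nhds_eq_of_surj` through p629361; p607548's level function;
p629XXX `HaarAnalyticZeroSetNowhereFlat`).  The α-guard (`α ≤ 1∕24`, `α < δ_N`, `157·α < L^{1−d}`) and the standing range are displayed as in w4's files; that the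
record's (2.9) threshold at `U = Θ^B(A)·U₀` IS `‖W − 1‖ < ε₁` with this `W` (i.e. `V_y = Θ^{B'}(y)·Ū(U₀)` on the fibre) is the junction's bookkeeping (w2 ∕ w4), not
claimed here; the continuity clause of the density (N07's continuity of the minimiser) is untouched; NOTHING of Bałaban's asserted; `hreg`∕`hgc`∕`contTOn` NOT discharged;
N09 NOT discharged; conjunct 1 (Lemma 4) ∕ FLAG №7 untouched; K0⁷ ∕ K1⁹ ∕ K3⁸ NOT closed; counts unmoved (typed 28∕28 · discharged 5∕28); one finite four-torus programme
at fixed `ε = L^{−K}` per run — R4 closes the conditional rung `BalabanLadder.UV` only; NOT ℝ⁴ ∕ infinite volume ∕ OS; the Yang–Mills mass gap (Clay) is NOT proved by any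
of this.
-/

noncomputable section

open Filter Topology Set Function
open scoped Matrix.Norms.L2Operator

namespace Summit.QuantumFields.YangMills.BalabanUVNodes.N09Chi29ThresholdsNowhereFibreFlat

open Literature.MathematicalPhysics.QuantumFieldTheory.Balaban1983to89
open Literature.MathematicalPhysics.QuantumFieldTheory.Balaban1983to89.HaarExponentialChart
open Literature.MathematicalPhysics.QuantumFieldTheory.Balaban1983to89.HaarExponentialChart.IsChartRep
open Literature.MathematicalPhysics.QuantumFieldTheory.Balaban1983to89.BlockAveraging (Small Idx avgFun loopHol)
open Literature.MathematicalPhysics.QuantumFieldTheory.Balaban1983to89.BlockAveragingHaarAC (centralBond)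
open Literature.MathematicalPhysics.QuantumFieldTheory.Balaban1983to89.ExpMeanLog (expMeanLogSU deltaSU)
open Literature.MathematicalPhysics.QuantumFieldTheory.Balaban1983to89.Node00
open Summit.QuantumFields.YangMills.BalabanUVNodes.N09ChartReadAveragingSmooth (contDiffAt_chartRead_avgFun coe_expChart)
open Literature.MeasureTheory.Integral
open Summit.QuantumFields.YangMills.BalabanUVNodes.N09ChartReadAveragingSubmersion
  (exists_fderiv_chartRead_single_eq_single fderiv_chartRead_avgFun_range_eq_top)

/-! ## §0 Generic: surjectivity of the differential is an open condition; joint submersion with a coordinate near a point -/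

section Generic

variable {X E F : Type*} [TopologicalSpace X]
  [NormedAddCommGroup E] [NormedSpace ℝ E] [NormedAddCommGroup F] [NormedSpace ℝ F] [FiniteDimensional ℝ F]

/-- **Surjectivity is open**: a continuous family of continuous linear maps into a finite-dimensional space that is onto at `x₀` is onto near `x₀`
(right inverse `S` at `x₀`; `T x ∘ S` stays invertible nearby — units of `F →L F` are open). [cite: EvansGariepy1992, §3.4.3 Thm 2 (C¹-submersion special case; bookkeeping: submersions are stable)] -/
theorem eventually_range_eq_top {T : X → E →L[ℝ] F} {x₀ : X} (hT : ContinuousAt T x₀) (h0 : (T x₀).range = ⊤) :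
    ∀ᶠ x in 𝓝 x₀, (T x).range = ⊤ := by
  haveI : CompleteSpace F := FiniteDimensional.complete ℝ F
  obtain ⟨S, hS⟩ := (T x₀).exists_rightInverse_of_surjective h0
  have hc : Continuous fun A : E →L[ℝ] F => A.comp S := ((ContinuousLinearMap.compL ℝ F E F).flip S).continuous
  have hc' : ContinuousAt (fun x => (T x).comp S) x₀ := hc.continuousAt.comp hT
  have hunit : IsUnit ((T x₀).comp S) := by rw [hS]; exact isUnit_one
  have hev : ∀ᶠ x in 𝓝 x₀, IsUnit ((T x).comp S) := hc'.preimage_mem_nhds (Units.isOpen.mem_nhds hunit)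
  filter_upwards [hev] with x hx
  refine LinearMap.range_eq_top.2 fun y => ?_
  obtain ⟨u, hu⟩ := hx
  refine ⟨S ((↑u⁻¹ : F →L[ℝ] F) y), ?_⟩
  have h1 : ((T x).comp S) ((↑u⁻¹ : F →L[ℝ] F) y) = y := by
    rw [← hu]
    show (u * u⁻¹ : (F →L[ℝ] F)ˣ).val y = y
    rw [mul_inv_cancel]; rfl
  rw [ContinuousLinearMap.comp_apply] at h1
  exact h1

/-- **Joint submersion with a coordinate, near a point**: `M : E → F` of class `C¹` at `a` and a continuous linear `P : E →L G` with `(DM(a), P)` onto ⇒ on a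
neighbourhood of `a`, `M` is strictly differentiable and `(DM(x), P)` is onto. [cite: EvansGariepy1992, §3.4.3 Thm 2 (C¹-submersion special case; bookkeeping: submersions are stable)] -/
theorem eventually_hasStrictFDerivAt_prod_range_eq_top {G : Type*} [NormedAddCommGroup G] [NormedSpace ℝ G] [FiniteDimensional ℝ G]
    [CompleteSpace E] {M : E → F} {a : E} (hM : ContDiffAt ℝ 1 M a)
    (P : E →L[ℝ] G) (h0 : ((fderiv ℝ M a).prod P).range = ⊤) :
    ∀ᶠ x in 𝓝 a, HasStrictFDerivAt M (fderiv ℝ M x) x ∧ ((fderiv ℝ M x).prod P).range = ⊤ := by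
  have hC : ∀ᶠ x in 𝓝 a, ContDiffAt ℝ 1 M x := hM.eventually (by simp)
  have hcont : ContinuousAt (fun x => (fderiv ℝ M x).prod P) a := by
    have h1 : ContinuousAt (fderiv ℝ M) a := hM.continuousAt_fderiv one_ne_zero
    have h2 : ContinuousAt (fun x => (fderiv ℝ M x, P)) a := h1.prodMk continuousAt_const
    exact (ContinuousLinearMap.prodₗᵢ ℝ : ((E →L[ℝ] F) × (E →L[ℝ] G)) ≃ₗᵢ[ℝ] (E →L[ℝ] F × G)).continuous.continuousAt.comp h2
  exact (hC.and (eventually_range_eq_top hcont h0)).mono fun x hx => ⟨hx.1.hasStrictFDerivAt one_ne_zero, hx.2⟩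

end Generic

/-! ## §1 The chart-read (0.4) average and a NON-CENTRAL bond coordinate are a JOINT submersion at `0`, hence near `0` -/

section Chart

variable {P : Params} {j : ℕ} {N : ℕ} [NeZero N]
variable {U₀ : GaugeField P j (SU N)}

/-- ★★ **`(Dψ_{U₀}(0), A ↦ A b)` IS ONTO for every NON-central bond `b`** (on the α-guard, standing range): the onto-preimages of dag-n09-w4 g5's
`exists_fderiv_chartRead_single_eq_single` live on the CENTRAL bonds, so the `b`-coordinate can be prescribed independently.
[cite: Balaban1987RG1, (0.4), (0.8) p.253 and p.267; Balaban1985Averaging, Prop. 3 (122)–(124) p.36] -/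
theorem range_fderiv_chartRead_prod_proj_eq_top (hj : j + 1 ≤ P.m + P.K) {α : ℝ} (hα : ∀ c i, dist1 (loopHol U₀ c i) ≤ α) (hα24 : α ≤ 1 / 24)
    (hαδ : α < deltaSU (Fin N)) (hαL : 157 * α < ((P.L : ℝ) ^ (P.d - 1))⁻¹) {b : PBond P j} (hb : ∀ c, centralBond c ≠ b) :
    ((fderiv ℝ (fun (A : PBond P j → (specialUnitaryLogChart (Fin N)).lie) (c : PBond P (j + 1)) =>
      (isChartRep_specialUnitaryGroup (n := Fin N)).logChart
        (avgFun (expMeanLogSU (n := Fin N)) (fun b => (isChartRep_specialUnitaryGroup (n := Fin N)).expChart (A b) * U₀ b) c *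
          (avgFun (expMeanLogSU (n := Fin N)) U₀ c)⁻¹)) 0).prod
      (ContinuousLinearMap.proj (R := ℝ) (φ := fun _ : PBond P j => (specialUnitaryLogChart (Fin N)).lie) b)).range = ⊤ := by
  classical
  set L := fderiv ℝ (fun (A : PBond P j → (specialUnitaryLogChart (Fin N)).lie) (c : PBond P (j + 1)) =>
      (isChartRep_specialUnitaryGroup (n := Fin N)).logChart
        (avgFun (expMeanLogSU (n := Fin N)) (fun b => (isChartRep_specialUnitaryGroup (n := Fin N)).expChart (A b) * U₀ b) c *
          (avgFun (expMeanLogSU (n := Fin N)) U₀ c)⁻¹)) 0 with hL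
  refine LinearMap.range_eq_top.2 fun Zξ => ?_
  obtain ⟨Z, ξ⟩ := Zξ
  set W : PBond P (j + 1) → (specialUnitaryLogChart (Fin N)).lie := L (Pi.single b ξ) with hW
  choose X hX using fun c => exists_fderiv_chartRead_single_eq_single (P := P) (j := j) hj hα hα24 hαδ hαL c ((Z - W) c)
  refine ⟨(∑ c, Pi.single (centralBond c) (X c)) + Pi.single b ξ, ?_⟩
  have hcentral : L (∑ c, Pi.single (centralBond c) (X c)) = Z - W := by
    rw [map_sum]
    have hXc : ∀ c, L (Pi.single (centralBond c) (X c)) = Pi.single c ((Z - W) c) := fun c => hX c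
    simp_rw [hXc]
    exact Finset.univ_sum_single (Z - W)
  refine Prod.ext ?_ ?_
  · show L ((∑ c, Pi.single (centralBond c) (X c)) + Pi.single b ξ) = Z
    rw [map_add, hcentral, ← hW, sub_add_cancel]
  · show ((∑ c, (Pi.single (centralBond c) (X c) : PBond P j → (specialUnitaryLogChart (Fin N)).lie)) +
        (Pi.single b ξ : PBond P j → (specialUnitaryLogChart (Fin N)).lie)) b = ξ
    rw [Pi.add_apply, Finset.sum_apply, Pi.single_eq_same]
    have h0 : ∑ c, (Pi.single (centralBond c) (X c) : PBond P j → (specialUnitaryLogChart (Fin N)).lie) b = 0 :=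
      Finset.sum_eq_zero fun c _ => Pi.single_eq_of_ne (hb c).symm _
    rw [h0, zero_add]

/-- ★★★ **JOINT SUBMERSION NEAR `0`**: on an open neighbourhood `O₀ ∋ 0` of the chart, for EVERY non-central bond `b`, the chart-read average is strictly
differentiable and `(Dψ_{U₀}(A), A ↦ A b)` is onto — the `hsub` input of `AnalyticSubmersion.nowhereFibreFlat_of_submersiveCoordinates` for the bond coordinates.
[cite: Balaban1987RG1, (0.4) p.253 and (2.10) p.267] -/
theorem exists_nhds_submersive_bondCoordinates (hj : j + 1 ≤ P.m + P.K) {α : ℝ} (hα : ∀ c i, dist1 (loopHol U₀ c i) ≤ α) (hα24 : α ≤ 1 / 24)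
    (hαδ : α < deltaSU (Fin N)) (hαL : 157 * α < ((P.L : ℝ) ^ (P.d - 1))⁻¹) :
    ∃ O₀ : Set (PBond P j → (specialUnitaryLogChart (Fin N)).lie), IsOpen O₀ ∧ (0 : PBond P j → (specialUnitaryLogChart (Fin N)).lie) ∈ O₀ ∧
      ∀ A ∈ O₀, ∀ b : PBond P j, (∀ c, centralBond c ≠ b) →
        ∃ (M' : (PBond P j → (specialUnitaryLogChart (Fin N)).lie) →L[ℝ] (PBond P (j + 1) → (specialUnitaryLogChart (Fin N)).lie))
          (P' : (PBond P j → (specialUnitaryLogChart (Fin N)).lie) →L[ℝ] (specialUnitaryLogChart (Fin N)).lie),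
          HasStrictFDerivAt (fun (A : PBond P j → (specialUnitaryLogChart (Fin N)).lie) (c : PBond P (j + 1)) =>
              (isChartRep_specialUnitaryGroup (n := Fin N)).logChart
                (avgFun (expMeanLogSU (n := Fin N)) (fun b => (isChartRep_specialUnitaryGroup (n := Fin N)).expChart (A b) * U₀ b) c *
                  (avgFun (expMeanLogSU (n := Fin N)) U₀ c)⁻¹)) M' A ∧
            HasStrictFDerivAt (fun A' : PBond P j → (specialUnitaryLogChart (Fin N)).lie => A' b) P' A ∧ (M'.prod P').range = ⊤ := by
  classical
  have hsmall : ∀ c, Small (expMeanLogSU (n := Fin N)) U₀ c := fun c i => lt_of_le_of_lt (hα c i) hαδ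
  have hCω := contDiffAt_chartRead_avgFun (P := P) (j := j) U₀ hsmall
  have hC1 : ContDiffAt ℝ 1 (fun (A : PBond P j → (specialUnitaryLogChart (Fin N)).lie) (c : PBond P (j + 1)) =>
      (isChartRep_specialUnitaryGroup (n := Fin N)).logChart
        (avgFun (expMeanLogSU (n := Fin N)) (fun b => (isChartRep_specialUnitaryGroup (n := Fin N)).expChart (A b) * U₀ b) c *
          (avgFun (expMeanLogSU (n := Fin N)) U₀ c)⁻¹)) 0 := hCω.of_le le_top
  -- for each non-central bond an eventual statement; finitely many bonds
  have hev : ∀ b : PBond P j, (∀ c, centralBond c ≠ b) → ∀ᶠ A in 𝓝 (0 : PBond P j → (specialUnitaryLogChart (Fin N)).lie),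
      HasStrictFDerivAt (fun (A : PBond P j → (specialUnitaryLogChart (Fin N)).lie) (c : PBond P (j + 1)) =>
          (isChartRep_specialUnitaryGroup (n := Fin N)).logChart
            (avgFun (expMeanLogSU (n := Fin N)) (fun b => (isChartRep_specialUnitaryGroup (n := Fin N)).expChart (A b) * U₀ b) c *
              (avgFun (expMeanLogSU (n := Fin N)) U₀ c)⁻¹)) (fderiv ℝ (fun (A : PBond P j → (specialUnitaryLogChart (Fin N)).lie) (c : PBond P (j + 1)) =>
          (isChartRep_specialUnitaryGroup (n := Fin N)).logChart
            (avgFun (expMeanLogSU (n := Fin N)) (fun b => (isChartRep_specialUnitaryGroup (n := Fin N)).expChart (A b) * U₀ b) c *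
              (avgFun (expMeanLogSU (n := Fin N)) U₀ c)⁻¹)) A) A ∧
        ((fderiv ℝ (fun (A : PBond P j → (specialUnitaryLogChart (Fin N)).lie) (c : PBond P (j + 1)) =>
          (isChartRep_specialUnitaryGroup (n := Fin N)).logChart
            (avgFun (expMeanLogSU (n := Fin N)) (fun b => (isChartRep_specialUnitaryGroup (n := Fin N)).expChart (A b) * U₀ b) c *
              (avgFun (expMeanLogSU (n := Fin N)) U₀ c)⁻¹)) A).prod
          (ContinuousLinearMap.proj (R := ℝ) (φ := fun _ : PBond P j => (specialUnitaryLogChart (Fin N)).lie) b)).range = ⊤ := by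
    intro b hb
    haveI : CompleteSpace (PBond P j → (specialUnitaryLogChart (Fin N)).lie) := FiniteDimensional.complete ℝ _
    exact eventually_hasStrictFDerivAt_prod_range_eq_top hC1
      (ContinuousLinearMap.proj (R := ℝ) (φ := fun _ : PBond P j => (specialUnitaryLogChart (Fin N)).lie) b)
      (range_fderiv_chartRead_prod_proj_eq_top hj hα hα24 hαδ hαL hb)
  have hall := eventually_all.2 fun b : PBond P j =>
    show ∀ᶠ A in 𝓝 (0 : PBond P j → (specialUnitaryLogChart (Fin N)).lie), (∀ c, centralBond c ≠ b) → _ from by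
      by_cases hb : ∀ c, centralBond c ≠ b
      · exact (hev b hb).mono fun A hA _ => hA
      · exact Filter.Eventually.of_forall fun A h' => absurd h' hb
  obtain ⟨O₀, hO₀sub, hO₀o, h0⟩ := _root_.eventually_nhds_iff.1 hall
  exact ⟨O₀, hO₀o, h0, fun A hA b hb => ⟨_, _, (hO₀sub A hA b hb).1,
    (ContinuousLinearMap.proj (R := ℝ) (φ := fun _ : PBond P j => (specialUnitaryLogChart (Fin N)).lie) b).hasStrictFDerivAt,
    (hO₀sub A hA b hb).2⟩⟩

end Chart

/-! ## §2 The (2.9) DETERMINANT FAMILY READ IN THE CHART: fibrewise analytic, factoring through the bond coordinate, NOWHERE FIBRE-FLAT near `0` -/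

section DetFamily

variable {P : Params} {j : ℕ} {N : ℕ} [NeZero N]
variable (U₀ : GaugeField P j (SU N))
variable (h : PBond P j → (PBond P (j + 1) → (specialUnitaryLogChart (Fin N)).lie) → SU N) (r : ℝ)

/-- ★ **EVERY MEMBER OF THE DETERMINANT FAMILY IS REAL-ANALYTIC IN THE FINE CHART VARIABLE** (for EVERY coarse chart point `y` and every «critical letter»
`h b y ∈ SU(N)` — no regularity of `h` in `y` is needed): `A ↦ normSq det((r²−2)·1 + W + Wᴴ)`, `W = ↑(h b y)·e^{A b}·↑U₀(b)`, is the composite of the coordinate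
projection, the entire `exp` of `𝔰𝔲(N) ⊂ M_N(ℂ)`, matrix products, `det` and `normSq`. [cite: Balaban1987RG1, (2.9) p.266 and (2.10) p.267; HornJohnson2013, §0.3] -/
theorem analyticOnNhd_detFamily (b : PBond P j) (y : PBond P (j + 1) → (specialUnitaryLogChart (Fin N)).lie) :
    AnalyticOnNhd ℝ (fun A : PBond P j → (specialUnitaryLogChart (Fin N)).lie =>
      Complex.normSq ((((r ^ 2 - 2 : ℝ) : ℂ)) • (1 : Matrix (Fin N) (Fin N) ℂ) +
        ((h b y : Matrix (Fin N) (Fin N) ℂ) * ((isChartRep_specialUnitaryGroup (n := Fin N)).expChart (A b) : Matrix (Fin N) (Fin N) ℂ) *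
          (U₀ b : Matrix (Fin N) (Fin N) ℂ)) +
        ((h b y : Matrix (Fin N) (Fin N) ℂ) * ((isChartRep_specialUnitaryGroup (n := Fin N)).expChart (A b) : Matrix (Fin N) (Fin N) ℂ) *
          (U₀ b : Matrix (Fin N) (Fin N) ℂ)).conjTranspose).det) univ := by
  -- the unitary letter `A ↦ ↑(h b y)·e^{A b}·↑U₀(b)` is analytic
  have hexp : AnalyticOnNhd ℝ (fun A : PBond P j → (specialUnitaryLogChart (Fin N)).lie =>
      ((isChartRep_specialUnitaryGroup (n := Fin N)).expChart (A b) : Matrix (Fin N) (Fin N) ℂ)) univ := by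
    have heq : (fun A : PBond P j → (specialUnitaryLogChart (Fin N)).lie =>
        ((isChartRep_specialUnitaryGroup (n := Fin N)).expChart (A b) : Matrix (Fin N) (Fin N) ℂ)) =
        fun A => NormedSpace.exp (((A b : (specialUnitaryLogChart (Fin N)).lie) : Matrix (Fin N) (Fin N) ℂ)) :=
      funext fun A => coe_expChart (A b)
    rw [heq]
    intro A _
    have hval : ContDiff ℝ ⊤ (fun A : PBond P j → (specialUnitaryLogChart (Fin N)).lie =>
        ((A b : (specialUnitaryLogChart (Fin N)).lie) : Matrix (Fin N) (Fin N) ℂ)) :=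
      ((specialUnitaryLogChart (Fin N)).lie.subtypeL.contDiff).comp (contDiff_apply ℝ ((specialUnitaryLogChart (Fin N)).lie) b)
    have h1 : AnalyticAt ℝ (fun A : PBond P j → (specialUnitaryLogChart (Fin N)).lie => ((A b : (specialUnitaryLogChart (Fin N)).lie) :
        Matrix (Fin N) (Fin N) ℂ)) A := hval.contDiffAt.analyticAt
    exact (NormedSpace.exp_analytic _).comp h1
  have hW : AnalyticOnNhd ℝ (fun A : PBond P j → (specialUnitaryLogChart (Fin N)).lie =>
      (h b y : Matrix (Fin N) (Fin N) ℂ) * ((isChartRep_specialUnitaryGroup (n := Fin N)).expChart (A b) : Matrix (Fin N) (Fin N) ℂ) *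
        (U₀ b : Matrix (Fin N) (Fin N) ℂ)) univ :=
    fun A hA => (analyticAt_const.mul (hexp A hA)).mul analyticAt_const
  have hdet := HaarDist1LevelHypersurface.analyticOnNhd_det_level_comp hW (((r ^ 2 - 2 : ℝ) : ℂ))
  intro A hA
  have hF := hdet A hA
  have hre := (Complex.reCLM.analyticAt _).comp hF
  have him := (Complex.imCLM.analyticAt _).comp hF
  have hsum := (hre.mul hre).add (him.mul him)
  refine hsum.congr (Filter.Eventually.of_forall fun A' => ?_)
  simp only [Pi.add_apply, Pi.mul_apply, Function.comp_apply, Complex.reCLM_apply, Complex.imCLM_apply, Complex.normSq_apply]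

/-- ★★★ **THE (2.9) DETERMINANT FAMILY, READ IN THE CHART AT `U₀`, IS NOWHERE FIBRE-FLAT NEAR `0` along the chart-read (0.4) average — for EVERY `r ≠ 0` and
EVERY critical letter `h`** (at the record `h b y = V^{(j)}(Θ^{B'}(y)·Ū(U₀))(b)⁻¹`, `r = ε₁`; nothing of its regularity in `y` enters).  The chart-read average `ψ` and the
family `Γ` enter through DEFINING EQUATIONS (`hψ`, `hΓ`; instantiate with `rfl`): `Γ i y A = normSq det((r²−2)·1 + W + Wᴴ)`, `W = ↑(h i y)·e^{A i}·↑U₀(i)` over the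
NON-central bonds `i`.  Conclusion: an open `O₀ ∋ 0` inside the chart box on which `Γ i (ψ A) A = 0 ⇒ ∃ᶠ A' → A` ON THE FIBRE `ψ⁻¹(ψ A)` with `Γ i (ψ A) A' ≠ 0` —
§1's joint submersion + `HaarAnalyticZeroSetNowhereFlat.frequently_normSq_detLevel_conj_expChart_ne_zero` through `AnalyticSubmersion.nowhereFibreFlat_of_submersiveCoordinates`.
This is the «nowhere fibre-flat» input of the flat-locus sharp engine for the (2.9) thresholds on road B; transversality is NOT needed and NOT claimed.
[cite: Balaban1987RG1, (2.9) p.266 and (2.10) p.267] [cite: Mityagin2015, Proposition 1] -/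
theorem exists_nhds_nowhereFibreFlat_detFamily (hj : j + 1 ≤ P.m + P.K) {α : ℝ} (hα : ∀ c i, dist1 (loopHol U₀ c i) ≤ α) (hα24 : α ≤ 1 / 24)
    (hαδ : α < deltaSU (Fin N)) (hαL : 157 * α < ((P.L : ℝ) ^ (P.d - 1))⁻¹) (hr : r ≠ 0)
    {ψ : (PBond P j → (specialUnitaryLogChart (Fin N)).lie) → PBond P (j + 1) → (specialUnitaryLogChart (Fin N)).lie}
    (hψ : ψ = fun A c => (isChartRep_specialUnitaryGroup (n := Fin N)).logChart
        (avgFun (expMeanLogSU (n := Fin N)) (fun b => (isChartRep_specialUnitaryGroup (n := Fin N)).expChart (A b) * U₀ b) c *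
          (avgFun (expMeanLogSU (n := Fin N)) U₀ c)⁻¹))
    {Γ : {b : PBond P j // ∀ c, centralBond c ≠ b} → (PBond P (j + 1) → (specialUnitaryLogChart (Fin N)).lie) →
      (PBond P j → (specialUnitaryLogChart (Fin N)).lie) → ℝ}
    (hΓ : ∀ i y A, Γ i y A = Complex.normSq ((((r ^ 2 - 2 : ℝ) : ℂ)) • (1 : Matrix (Fin N) (Fin N) ℂ) +
        ((h i.1 y : Matrix (Fin N) (Fin N) ℂ) * ((isChartRep_specialUnitaryGroup (n := Fin N)).expChart (A i.1) : Matrix (Fin N) (Fin N) ℂ) *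
          (U₀ i.1 : Matrix (Fin N) (Fin N) ℂ)) +
        ((h i.1 y : Matrix (Fin N) (Fin N) ℂ) * ((isChartRep_specialUnitaryGroup (n := Fin N)).expChart (A i.1) : Matrix (Fin N) (Fin N) ℂ) *
          (U₀ i.1 : Matrix (Fin N) (Fin N) ℂ)).conjTranspose).det) :
    ∃ O₀ : Set (PBond P j → (specialUnitaryLogChart (Fin N)).lie), IsOpen O₀ ∧ (0 : PBond P j → (specialUnitaryLogChart (Fin N)).lie) ∈ O₀ ∧
      (∀ A ∈ O₀, ∀ b, ‖A b‖ < chartRadius (specialUnitaryLogChart (Fin N))) ∧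
      ∀ A ∈ O₀, ∀ i, Γ i (ψ A) A = 0 → ∃ᶠ A' in 𝓝[ψ ⁻¹' {ψ A}] A, Γ i (ψ A) A' ≠ 0 := by
  classical
  obtain ⟨O₁, hO₁o, h0O₁, hsub⟩ := exists_nhds_submersive_bondCoordinates (U₀ := U₀) hj hα hα24 hαδ hαL
  have hBxo : IsOpen (Set.pi univ fun _ : PBond P j => Metric.ball (0 : (specialUnitaryLogChart (Fin N)).lie)
      (chartRadius (specialUnitaryLogChart (Fin N)))) :=
    isOpen_set_pi finite_univ fun _ _ => Metric.isOpen_ball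
  have h0Bx : (0 : PBond P j → (specialUnitaryLogChart (Fin N)).lie) ∈
      Set.pi univ fun _ : PBond P j => Metric.ball (0 : (specialUnitaryLogChart (Fin N)).lie) (chartRadius (specialUnitaryLogChart (Fin N))) :=
    Set.mem_univ_pi.2 fun _ => Metric.mem_ball_self (chartRadius_pos (C := specialUnitaryLogChart (Fin N)))
  have hbox : ∀ A ∈ O₁ ∩ Set.pi univ fun _ : PBond P j => Metric.ball (0 : (specialUnitaryLogChart (Fin N)).lie)
      (chartRadius (specialUnitaryLogChart (Fin N))), ∀ b, ‖A b‖ < chartRadius (specialUnitaryLogChart (Fin N)) :=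
    fun A hA b => mem_ball_zero_iff.1 (Set.mem_univ_pi.1 hA.2 b)
  refine ⟨O₁ ∩ Set.pi univ fun _ : PBond P j => Metric.ball (0 : (specialUnitaryLogChart (Fin N)).lie) (chartRadius (specialUnitaryLogChart (Fin N))),
    hO₁o.inter hBxo, ⟨h0O₁, h0Bx⟩, hbox, ?_⟩
  refine AnalyticSubmersion.nowhereFibreFlat_of_submersiveCoordinates
    (G := fun _ : {b : PBond P j // ∀ c, centralBond c ≠ b} => (specialUnitaryLogChart (Fin N)).lie)
    (fun (i : {b : PBond P j // ∀ c, centralBond c ≠ b}) (A : PBond P j → (specialUnitaryLogChart (Fin N)).lie) => A i.1)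
    (fun i y X => Complex.normSq ((((r ^ 2 - 2 : ℝ) : ℂ)) • (1 : Matrix (Fin N) (Fin N) ℂ) +
      ((h i.1 y : Matrix (Fin N) (Fin N) ℂ) * ((isChartRep_specialUnitaryGroup (n := Fin N)).expChart X : Matrix (Fin N) (Fin N) ℂ) *
        (U₀ i.1 : Matrix (Fin N) (Fin N) ℂ)) +
      ((h i.1 y : Matrix (Fin N) (Fin N) ℂ) * ((isChartRep_specialUnitaryGroup (n := Fin N)).expChart X : Matrix (Fin N) (Fin N) ℂ) *
        (U₀ i.1 : Matrix (Fin N) (Fin N) ℂ)).conjTranspose).det)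
    hΓ (fun A' hA' i' => ?_) (fun A' hA' i' => ?_)
  · exact HaarAnalyticZeroSetNowhereFlat.frequently_normSq_detLevel_conj_expChart_ne_zero (h i'.1 (ψ A')) (U₀ i'.1) hr (hbox A' hA' i'.1)
  · obtain ⟨M', P', hM', hP', hrange⟩ := hsub A' hA'.1 i'.1 i'.2
    refine ⟨M', P', ?_, hP', hrange⟩
    rw [hψ]
    exact hM'

end DetFamily

end Summit.QuantumFields.YangMills.BalabanUVNodes.N09Chi29ThresholdsNowhereFibreFlat

end
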